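import Summits.CriticalPhenomena.PercolationContinuityZ3.Theorems.PercNearOneGluingNoHeavyLowerTailSahiGridPatternTwoChartSharpInj

/-!
# `NoHeavyLowerTail` (crux stmt-CriticalPhenomena-4575), Sahi programme P1: **THE SHARPENED TWO-CHART TRANSPORT LEMMA, II — THE THEOREM**
# `Σ_{U} [(1_{D₁} − 1_{b'})(1_{E₁} − 1_{c'}) + (1_{E₂} − 1_{b'})(1_{D₂} − 1_{c'})] ≥ 2·#(U ∩ (b'∖b) ∩ (c'∖c))` (generation 30's CLAIM⁺)

Support file (Sahi cell, seat `prim-sahi-p1`, generation 31; `--supports stmt-CriticalPhenomena-4575`).  Pure proofs, NO definitions, no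
`sorry`, standard axioms.  Continues `…SahiGridPatternTwoChartSharpInj` (Hall injections, one-sided injection count `sharp_half_count`).

THE MATHEMATICS.  Two finite posets `α, β`; up-sets `U`, `b ⊆ b'`, `c ⊆ c'` of `α × β`; arms `A_b × β ∪ α × G_b ⊆ b`, `A_c × β ∪ α × G_c ⊆ c`;
sets `D₁, D₂ ⊆ α`, `E₁, E₂ ⊆ β` HK-dominated by the arms of `b, c`: `#(V∩D₁) ≤ #(V∩A_b)`, `#(V∩D₂) ≤ #(V∩A_c)` (all up-sets `V ⊆ α`),
`#(W∩E₁) ≤ #(W∩G_c)`, `#(W∩E₂) ≤ #(W∩G_b)` (all up-sets `W ⊆ β`).  THEOREM (**`twoChart_sum_sharp`**):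
  `2·#(U ∩ (b'∖b) ∩ (c'∖c)) ≤ Σ_{(x,y)∈U} [(1_{D₁}(x) − 1_{b'})(1_{E₁}(y) − 1_{c'}) + (1_{E₂}(y) − 1_{b'})(1_{D₂}(x) − 1_{c'})]`.
For `b' = b`, `c' = c` this is generation 19's `twoChart_sum_nonneg` (there proved by a counting chain, and with monotonicity hypotheses on
arms and corners that the injection proof does not need: **`twoChart_sum_nonneg'`**).  Writing `t(B,C)` for the right-hand side with FIXED
corners, `t` is affine in each argument with `t(b',c') − t(b',c) − t(b,c') + t(b,c) = 2·#(U∩(b'∖b)∩(c'∖c))`, so the theorem says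
`t(b,c) ≤ t(b',c) + t(b,c')` — generation 30's 'chart-wise CB⁺' in the application (`α = 2^T`, `β = 2^{Tᶜ}`, `b = X ⊆ b' = X'`,
`c = Y ⊆ c' = Y'`, corners from `X` and `Y`), which by generation 30's memo §3.3–3.4 gives CB⁺ for every top cube and, through the
Erdős–Herzog–Schönheim matching in the `V`-cubes, CONJECTURE D (diagonal routing of every top-cube up-set `S`, every `j, k`).
PROOF.  Pointwise on `U` (`pw_sharp`): `(1_{D₁} − 1_{b'})(1_{E₁} − 1_{c'}) ≥ [P₁] − [S_R] − [S_C] − [S_D] + [b'∖b ∩ c'∖c]` with the unit sets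
of `…TwoChartSharpInj`; summing, adding the mirror chart, and inserting the two instances of `sharp_half_count` (whose collision terms
cancel) closes the count.  Generation 30's LP finding (no aggregate Harris–Kleitman chain proves CLAIM⁺) is consistent: the injection uses
the matchings themselves, not only their cardinality shadows.  Nothing here mentions `sStarD`; nothing asserts `PatternPos d` for any
`d ≥ 4`. [this work]
-/

namespace Summit.CriticalPhenomena.PercolationContinuityZ3.Theorems.SahiGridPattern

open Finset SahiGrid3
open scoped BigOperators

section Pointwise

variable {α β : Type*} [DecidableEq α] [DecidableEq β]

/-- Pointwise bookkeeping of the first chart: the chart term dominates `[P₁] − [S_R] − [S_C] − [S_D] + [b'∖b ∩ c'∖c]`. [this work] -/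
theorem pw_sharp (b c b' c' : Finset (α × β)) (D₁ : Finset α) (E₁ : Finset β) (p : α × β)
    (hbp : p ∈ b → p ∈ b') (hcp : p ∈ c → p ∈ c') :
    (if p ∈ b' ∧ p ∈ c' ∧ (p ∈ b ∨ p ∈ c) ∧ p.1 ∉ D₁ ∧ p.2 ∉ E₁ then (1:ℤ) else 0)
      - (if p ∈ b' ∧ p ∉ c ∧ (p ∉ c' ∨ p ∉ b) ∧ p.1 ∉ D₁ ∧ p.2 ∈ E₁ then (1:ℤ) else 0)
      - (if p ∈ c' ∧ p ∉ b ∧ (p ∉ b' ∨ p ∉ c) ∧ p.1 ∈ D₁ ∧ p.2 ∉ E₁ then (1:ℤ) else 0)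
      - (if p ∈ b' ∧ p ∈ c' ∧ p ∉ b ∧ p ∉ c ∧ p.1 ∈ D₁ ∧ p.2 ∈ E₁ then (1:ℤ) else 0)
      + (if p ∈ b' ∧ p ∉ b ∧ p ∈ c' ∧ p ∉ c then (1:ℤ) else 0)
      ≤ (ind D₁ p.1 - ind b' p) * (ind E₁ p.2 - ind c' p) := by
  unfold ind
  by_cases h1 : p ∈ b <;> by_cases h2 : p ∈ b' <;> by_cases h3 : p ∈ c <;> by_cases h4 : p ∈ c' <;>
    by_cases h5 : p.1 ∈ D₁ <;> by_cases h6 : p.2 ∈ E₁ <;>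
    first
    | exact absurd (hbp h1) h2
    | exact absurd (hcp h3) h4
    | simp [h1, h2, h3, h4, h5, h6]

end Pointwise

section Main

variable {α β : Type*} [PartialOrder α] [PartialOrder β] [Fintype α] [Fintype β] [DecidableEq α] [DecidableEq β]

omit [PartialOrder α] [PartialOrder β] [Fintype α] [Fintype β] in
/-- Summed bookkeeping of the first chart: `#P₁ − #S_R − #S_C − #S_D + #(U ∩ (b'∖b) ∩ (c'∖c)) ≤ Σ_U (1_{D₁} − 1_{b'})(1_{E₁} − 1_{c'})`.
[this work] -/
theorem sharp_half_sum (U b c b' c' : Finset (α × β)) (hbb' : b ⊆ b') (hcc' : c ⊆ c') (D₁ : Finset α) (E₁ : Finset β) :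
    (#(U.filter fun p => p ∈ b' ∧ p ∈ c' ∧ (p ∈ b ∨ p ∈ c) ∧ p.1 ∉ D₁ ∧ p.2 ∉ E₁) : ℤ)
      - #(U.filter fun p => p ∈ b' ∧ p ∉ c ∧ (p ∉ c' ∨ p ∉ b) ∧ p.1 ∉ D₁ ∧ p.2 ∈ E₁)
      - #(U.filter fun p => p ∈ c' ∧ p ∉ b ∧ (p ∉ b' ∨ p ∉ c) ∧ p.1 ∈ D₁ ∧ p.2 ∉ E₁)
      - #(U.filter fun p => p ∈ b' ∧ p ∈ c' ∧ p ∉ b ∧ p ∉ c ∧ p.1 ∈ D₁ ∧ p.2 ∈ E₁)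
      + #(U.filter fun p => p ∈ b' ∧ p ∉ b ∧ p ∈ c' ∧ p ∉ c)
      ≤ ∑ p ∈ U, (ind D₁ p.1 - ind b' p) * (ind E₁ p.2 - ind c' p) := by
  rw [natCast_card_filter, natCast_card_filter, natCast_card_filter, natCast_card_filter, natCast_card_filter,
    ← Finset.sum_sub_distrib, ← Finset.sum_sub_distrib, ← Finset.sum_sub_distrib, ← Finset.sum_add_distrib]
  exact Finset.sum_le_sum fun p _ => pw_sharp b c b' c' D₁ E₁ p (fun h => hbb' h) (fun h => hcc' h)

/-- **THE SHARPENED TWO-CHART TRANSPORT LEMMA** (generation 30's CLAIM⁺ / chart-wise CB⁺; see the module docstring).  For up-sets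
`U, b ⊆ b', c ⊆ c'` of `α × β`, arms `A_b × β, α × G_b ⊆ b`, `A_c × β, α × G_c ⊆ c`, and sets `D₁, D₂ ⊆ α`, `E₁, E₂ ⊆ β` with
`#(V∩D₁) ≤ #(V∩A_b)`, `#(V∩D₂) ≤ #(V∩A_c)`, `#(W∩E₁) ≤ #(W∩G_c)`, `#(W∩E₂) ≤ #(W∩G_b)` for all up-sets `V ⊆ α`, `W ⊆ β`:
`2·#(U ∩ (b'∖b) ∩ (c'∖c)) ≤ Σ_{(x,y)∈U} [(1_{D₁}(x) − 1_{b'})(1_{E₁}(y) − 1_{c'}) + (1_{E₂}(y) − 1_{b'})(1_{D₂}(x) − 1_{c'})]`. [this work] -/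
theorem twoChart_sum_sharp (U b c b' c' : Finset (α × β)) (hU : IsUpperSet (U : Set (α × β)))
    (hb : IsUpperSet (b : Set (α × β))) (hc : IsUpperSet (c : Set (α × β)))
    (hb' : IsUpperSet (b' : Set (α × β))) (hc' : IsUpperSet (c' : Set (α × β))) (hbb' : b ⊆ b') (hcc' : c ⊆ c')
    (Ab Ac D₁ D₂ : Finset α) (Gb Gc E₁ E₂ : Finset β)
    (hAb_b : ∀ x ∈ Ab, ∀ y, (x, y) ∈ b) (hGb_b : ∀ y ∈ Gb, ∀ x, (x, y) ∈ b)
    (hAc_c : ∀ x ∈ Ac, ∀ y, (x, y) ∈ c) (hGc_c : ∀ y ∈ Gc, ∀ x, (x, y) ∈ c)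
    (hk₁ : ∀ V : Finset α, IsUpperSet (V : Set α) → (V ∩ D₁).card ≤ (V ∩ Ab).card)
    (hk₂ : ∀ V : Finset α, IsUpperSet (V : Set α) → (V ∩ D₂).card ≤ (V ∩ Ac).card)
    (hk₃ : ∀ W : Finset β, IsUpperSet (W : Set β) → (W ∩ E₁).card ≤ (W ∩ Gc).card)
    (hk₄ : ∀ W : Finset β, IsUpperSet (W : Set β) → (W ∩ E₂).card ≤ (W ∩ Gb).card) :
    2 * (#(U ∩ (b' \ b) ∩ (c' \ c)) : ℤ) ≤
      ∑ p ∈ U, ((ind D₁ p.1 - ind b' p) * (ind E₁ p.2 - ind c' p) + (ind E₂ p.2 - ind b' p) * (ind D₂ p.1 - ind c' p)) := by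
  obtain ⟨κ, hκ, hκi⟩ := exists_upInj_of_hk D₁ Ab hk₁
  obtain ⟨κ', hκ', hκ'i⟩ := exists_upInj_of_hk D₂ Ac hk₂
  obtain ⟨ι, hι, hιi⟩ := exists_upInj_of_hk E₁ Gc hk₃
  obtain ⟨ι', hι', hι'i⟩ := exists_upInj_of_hk E₂ Gb hk₄
  have H1 := sharp_half_count U b c b' c' hU hb hc hb' hc' hbb' hcc' Ab Ac D₁ D₂ Gb Gc E₁ E₂ hAb_b hGb_b hAc_c hGc_c
    κ κ' ι ι' hκ hκi hι hιi hκ' hι'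
  have H2 := sharp_half_count U c b c' b' hU hc hb hc' hb' hcc' hbb' Ac Ab D₂ D₁ Gc Gb E₂ E₁ hAc_c hGc_c hAb_b hGb_b
    κ' κ ι' ι hκ' hκ'i hι' hι'i hκ hι
  have A1 := sharp_half_sum U b c b' c' hbb' hcc' D₁ E₁
  have A2 := sharp_half_sum U c b c' b' hcc' hbb' D₂ E₂
  have e1 : (U.filter fun p => p ∈ b' ∧ p ∉ b ∧ p ∈ c' ∧ p ∉ c) = U ∩ (b' \ b) ∩ (c' \ c) := by
    ext p; simp only [Finset.mem_filter, Finset.mem_inter, Finset.mem_sdiff]; tauto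
  have e2 : (U.filter fun p => p ∈ c' ∧ p ∉ c ∧ p ∈ b' ∧ p ∉ b) = U ∩ (b' \ b) ∩ (c' \ c) := by
    ext p; simp only [Finset.mem_filter, Finset.mem_inter, Finset.mem_sdiff]; tauto
  have e3 : (∑ p ∈ U, ((ind D₁ p.1 - ind b' p) * (ind E₁ p.2 - ind c' p) + (ind E₂ p.2 - ind b' p) * (ind D₂ p.1 - ind c' p)))
      = (∑ p ∈ U, (ind D₁ p.1 - ind b' p) * (ind E₁ p.2 - ind c' p))
        + ∑ p ∈ U, (ind D₂ p.1 - ind c' p) * (ind E₂ p.2 - ind b' p) := by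
    rw [← Finset.sum_add_distrib]
    exact Finset.sum_congr rfl fun p _ => by ring
  rw [e1] at A1
  rw [e2] at A2
  rw [e3]
  have H1' : ((#(U.filter fun p => p ∈ b' ∧ p ∉ c ∧ (p ∉ c' ∨ p ∉ b) ∧ p.1 ∉ D₁ ∧ p.2 ∈ E₁) : ℕ) : ℤ)
      + #(U.filter fun p => p ∈ c' ∧ p ∉ b ∧ (p ∉ b' ∨ p ∉ c) ∧ p.1 ∈ D₁ ∧ p.2 ∉ E₁)
      + #(U.filter fun p => p ∈ b' ∧ p ∈ c' ∧ p ∉ b ∧ p ∉ c ∧ p.1 ∈ D₁ ∧ p.2 ∈ E₁)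
      + #(((U.filter fun p => p ∈ c' ∧ p ∉ b ∧ (p ∉ b' ∨ p ∉ c) ∧ p.1 ∉ D₂ ∧ p.2 ∈ E₂).image fun p => (p.1, ι' p.2))
          ∩ ((U.filter fun p => p ∈ b' ∧ p ∉ c ∧ (p ∉ c' ∨ p ∉ b) ∧ p.1 ∈ D₂ ∧ p.2 ∉ E₂).image fun p => (κ' p.1, p.2)))
      ≤ #(U.filter fun p => p ∈ b' ∧ p ∈ c' ∧ (p ∈ b ∨ p ∈ c) ∧ p.1 ∉ D₁ ∧ p.2 ∉ E₁)
      + #(((U.filter fun p => p ∈ b' ∧ p ∉ c ∧ (p ∉ c' ∨ p ∉ b) ∧ p.1 ∉ D₁ ∧ p.2 ∈ E₁).image fun p => (p.1, ι p.2))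
          ∩ ((U.filter fun p => p ∈ c' ∧ p ∉ b ∧ (p ∉ b' ∨ p ∉ c) ∧ p.1 ∈ D₁ ∧ p.2 ∉ E₁).image fun p => (κ p.1, p.2))) := by
    exact_mod_cast H1
  have H2' : ((#(U.filter fun p => p ∈ c' ∧ p ∉ b ∧ (p ∉ b' ∨ p ∉ c) ∧ p.1 ∉ D₂ ∧ p.2 ∈ E₂) : ℕ) : ℤ)
      + #(U.filter fun p => p ∈ b' ∧ p ∉ c ∧ (p ∉ c' ∨ p ∉ b) ∧ p.1 ∈ D₂ ∧ p.2 ∉ E₂)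
      + #(U.filter fun p => p ∈ c' ∧ p ∈ b' ∧ p ∉ c ∧ p ∉ b ∧ p.1 ∈ D₂ ∧ p.2 ∈ E₂)
      + #(((U.filter fun p => p ∈ b' ∧ p ∉ c ∧ (p ∉ c' ∨ p ∉ b) ∧ p.1 ∉ D₁ ∧ p.2 ∈ E₁).image fun p => (p.1, ι p.2))
          ∩ ((U.filter fun p => p ∈ c' ∧ p ∉ b ∧ (p ∉ b' ∨ p ∉ c) ∧ p.1 ∈ D₁ ∧ p.2 ∉ E₁).image fun p => (κ p.1, p.2)))
      ≤ #(U.filter fun p => p ∈ c' ∧ p ∈ b' ∧ (p ∈ c ∨ p ∈ b) ∧ p.1 ∉ D₂ ∧ p.2 ∉ E₂)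
      + #(((U.filter fun p => p ∈ c' ∧ p ∉ b ∧ (p ∉ b' ∨ p ∉ c) ∧ p.1 ∉ D₂ ∧ p.2 ∈ E₂).image fun p => (p.1, ι' p.2))
          ∩ ((U.filter fun p => p ∈ b' ∧ p ∉ c ∧ (p ∉ c' ∨ p ∉ b) ∧ p.1 ∈ D₂ ∧ p.2 ∉ E₂).image fun p => (κ' p.1, p.2))) := by
    exact_mod_cast H2
  linarith

/-- **The two-chart transport lemma without monotonicity hypotheses** (`b' = b`, `c' = c` in `twoChart_sum_sharp`): generation 19's
`twoChart_sum_nonneg` holds for arbitrary arm sets inside `b, c` and arbitrary HK-dominated sets `D₁, D₂, E₁, E₂` (no up-set or down-set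
hypotheses on arms and corners). [this work] -/
theorem twoChart_sum_nonneg' (U b c : Finset (α × β)) (hU : IsUpperSet (U : Set (α × β)))
    (hb : IsUpperSet (b : Set (α × β))) (hc : IsUpperSet (c : Set (α × β)))
    (Ab Ac D₁ D₂ : Finset α) (Gb Gc E₁ E₂ : Finset β)
    (hAb_b : ∀ x ∈ Ab, ∀ y, (x, y) ∈ b) (hGb_b : ∀ y ∈ Gb, ∀ x, (x, y) ∈ b)
    (hAc_c : ∀ x ∈ Ac, ∀ y, (x, y) ∈ c) (hGc_c : ∀ y ∈ Gc, ∀ x, (x, y) ∈ c)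
    (hk₁ : ∀ V : Finset α, IsUpperSet (V : Set α) → (V ∩ D₁).card ≤ (V ∩ Ab).card)
    (hk₂ : ∀ V : Finset α, IsUpperSet (V : Set α) → (V ∩ D₂).card ≤ (V ∩ Ac).card)
    (hk₃ : ∀ W : Finset β, IsUpperSet (W : Set β) → (W ∩ E₁).card ≤ (W ∩ Gc).card)
    (hk₄ : ∀ W : Finset β, IsUpperSet (W : Set β) → (W ∩ E₂).card ≤ (W ∩ Gb).card) :
    0 ≤ ∑ p ∈ U, ((ind D₁ p.1 - ind b p) * (ind E₁ p.2 - ind c p) + (ind E₂ p.2 - ind b p) * (ind D₂ p.1 - ind c p)) := by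
  have h := twoChart_sum_sharp U b c b c hU hb hc hb hc (Finset.Subset.refl b) (Finset.Subset.refl c) Ab Ac D₁ D₂ Gb Gc E₁ E₂
    hAb_b hGb_b hAc_c hGc_c hk₁ hk₂ hk₃ hk₄
  have h0 : (0 : ℤ) ≤ 2 * (#(U ∩ (b \ b) ∩ (c \ c)) : ℤ) := by positivity
  linarith

/-- **Sum form of the sharpened lemma**: `0 ≤ Σ_{p∈U} [(1_{D₁} − 1_{b'})(1_{E₁} − 1_{c'}) + (1_{E₂} − 1_{b'})(1_{D₂} − 1_{c'}) − 2(1_{b'} − 1_b)(1_{c'} − 1_c)]`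
(the form used chart by chart on the top cube). [this work] -/
theorem twoChart_sum_sharp_sumForm (U b c b' c' : Finset (α × β)) (hU : IsUpperSet (U : Set (α × β)))
    (hb : IsUpperSet (b : Set (α × β))) (hc : IsUpperSet (c : Set (α × β)))
    (hb' : IsUpperSet (b' : Set (α × β))) (hc' : IsUpperSet (c' : Set (α × β))) (hbb' : b ⊆ b') (hcc' : c ⊆ c')
    (Ab Ac D₁ D₂ : Finset α) (Gb Gc E₁ E₂ : Finset β)
    (hAb_b : ∀ x ∈ Ab, ∀ y, (x, y) ∈ b) (hGb_b : ∀ y ∈ Gb, ∀ x, (x, y) ∈ b)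
    (hAc_c : ∀ x ∈ Ac, ∀ y, (x, y) ∈ c) (hGc_c : ∀ y ∈ Gc, ∀ x, (x, y) ∈ c)
    (hk₁ : ∀ V : Finset α, IsUpperSet (V : Set α) → (V ∩ D₁).card ≤ (V ∩ Ab).card)
    (hk₂ : ∀ V : Finset α, IsUpperSet (V : Set α) → (V ∩ D₂).card ≤ (V ∩ Ac).card)
    (hk₃ : ∀ W : Finset β, IsUpperSet (W : Set β) → (W ∩ E₁).card ≤ (W ∩ Gc).card)
    (hk₄ : ∀ W : Finset β, IsUpperSet (W : Set β) → (W ∩ E₂).card ≤ (W ∩ Gb).card) :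
    0 ≤ ∑ p ∈ U, ((ind D₁ p.1 - ind b' p) * (ind E₁ p.2 - ind c' p) + (ind E₂ p.2 - ind b' p) * (ind D₂ p.1 - ind c' p)
      - 2 * ((ind b' p - ind b p) * (ind c' p - ind c p))) := by
  have h := twoChart_sum_sharp U b c b' c' hU hb hc hb' hc' hbb' hcc' Ab Ac D₁ D₂ Gb Gc E₁ E₂ hAb_b hGb_b hAc_c hGc_c hk₁ hk₂ hk₃ hk₄
  have e : (∑ p ∈ U, (ind b' p - ind b p) * (ind c' p - ind c p)) = (#(U ∩ (b' \ b) ∩ (c' \ c)) : ℤ) := by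
    have e1 : (U.filter fun p => p ∈ b' ∧ p ∉ b ∧ p ∈ c' ∧ p ∉ c) = U ∩ (b' \ b) ∩ (c' \ c) := by
      ext p; simp only [Finset.mem_filter, Finset.mem_inter, Finset.mem_sdiff]; tauto
    rw [← e1, natCast_card_filter]
    refine Finset.sum_congr rfl fun p _ => ?_
    have hbp : p ∈ b → p ∈ b' := fun h => hbb' h
    have hcp : p ∈ c → p ∈ c' := fun h => hcc' h
    unfold ind
    by_cases h1 : p ∈ b <;> by_cases h2 : p ∈ b' <;> by_cases h3 : p ∈ c <;> by_cases h4 : p ∈ c' <;>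
      first
      | exact absurd (hbp h1) h2
      | exact absurd (hcp h3) h4
      | simp [h1, h2, h3, h4]
  rw [Finset.sum_sub_distrib, ← Finset.mul_sum, e]
  linarith

end Main

end Summit.CriticalPhenomena.PercolationContinuityZ3.Theorems.SahiGridPattern
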